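import Literature.AlgebraicGeometry.Motives.HodgeStructureExteriorAlgebraLefschetzInvolution
import Literature.AlgebraicGeometry.Motives.HodgeStructureDivisorClassesNumericalEquivalence
import HarnessLib

/-!
# Milne's `∗` (André's `*_H`) on a polarized `ℚ`-Hodge structure: `∗ = ε_r L^{g-k}` on the Lefschetz components, the pairing
# `tr(x ∧ ∗y)` is Lange's `P = Σ_r (-1)^{k(k-1)/2+r} Q_k(π_r ·, π_r ·)` in even degree, hence POSITIVE on Hodge classes
# (André: "les mêmes propriétés de positivité sur les cycles réels de type `(p,p)`"), and `∗Bᵖ = B^{g-p}`, `∗Dᵖ = D^{g-p}`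

[topic AlgebraicGeometry/Motives]

Layer `Literature/AlgebraicGeometry/Motives`, lane `lit-hodgefound` (Track 2 foundations library; prover seat `lit-hodgefound-p34`,
generation 29, row g29-#5). THEOREMS ONLY (no `def`, no named fact, no instance, no notation; net debt `0`). Sequel of row g29-#4
(`Motives/HodgeStructureExteriorAlgebraLefschetzInvolution`: `hodgeStar ω g = ∗` on `ExteriorAlgebra K W`, the printed formula
`∗(ωʳ ∧ p) = (-1)^{k(k+1)/2} ω^{g-k-r} ∧ p`), read on the CARRIER of the seat's generations 25–28: a `ℚ`-Hodge structure `H` of odd weight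
`n` on `V`, `dim V = 2g`, a polarization `Q` with Lefschetz class `E = E_Q` (`Q.isSymplectic_lefschetzClass`), the Lefschetz projections
`π_r = Q.lefschetzProj` onto `Lʳ P^{k-2r} = Q.lefschetzPart g k r`, Lange's form `P = Q.totalLefschetzForm` (the form of the polarization
`Q.exteriorPower` of `⋀ᵏ H`), the Hodge classes `Bᵖ ⊆ ⋀^{2p} V` and the divisor classes `Dᵖ = H.divisorClasses p`.

## Sources, VERBATIM

Y. André, *Pour une théorie inconditionnelle des motifs*, Publ. Math. IHÉS **83** (1996) [Andre1996Motifs], §1.1 (p. 10): "On définit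
aussi les involutions de Lefschetz et de Hodge respectivement par les formules : `*_L x = Σ L^{d-j+k} x_{j-2k}`,
`*_H x = Σ (-1)^{(j-2k)(j-2k+1)/2} L^{d-j+k} x_{j-2k}`", (p. 11): "Si `K ⊂ ℂ` et `H*` est la cohomologie de Betti, […] l'opérateur star
de Hodge relatif à une forme de Kähler représentant la classe `η` est le conjugué complexe de […]; le point important, qui justifie
l'introduction de `*_H` est que cet opérateur star et `*_H` ont les mêmes propriétés de positivité sur les cycles réels de type `(p,p)`.
[…] Remarquons aussi que `L`, `*_L`, `*_H` et `ᶜΛ` sont auto-adjoints relativement à l'accouplement de dualité de Poincaré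
`(x, y) ↦ ∫ x ∪ y`"; Prop. 1.2 (p. 11): "Via cet isomorphisme, la transposition relative à la forme bilinéaire `(x, y) ↦ ∫ x ∪ *y`
correspond à la transposition des matrices, pour `* = *_L` ou `*_H`."
J. S. Milne, *Lefschetz classes on abelian varieties*, Duke Math. J. **96** (1999) [Milne1999LefschetzClasses], p. 664 (`∗`), Thm. 5.9
(p. 665: "`Λ`, `ᶜΛ`, and `∗` […] are all Lefschetz"), Prop. 5.7 (p. 664: "If `u` is Lefschetz, then `ū` maps `D(A)_k` into `D(B)_k`").
H. Lange, *Abelian Varieties over the Complex Numbers* (2023) [Lange2023AbelianVarietiesComplex], §5.4.1 (5.24) (the form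
`Σ (-1)^{k(k-1)/2+r} Q_k` on the Lefschetz components) and Thm. 5.4.2 / Lemma 5.4.3; C. Voisin, *Hodge Theory and Complex Algebraic
Geometry I* [Voisin2002], Thm. 6.32 (Hodge–Riemann bilinear relations) and Lemma 6.31 (orthogonality of the Lefschetz decomposition).

## What is PROVED (`E = E_Q`, `∗ = hodgeStar E g`, `k ≤ g`, `2p ≤ g` unless said otherwise)

* §1 **`Polarization.hodgeStar_apply_of_mem_lefschetzPart` — `∗ = (-1)^{(k-2r)(k-2r+1)/2} · L^{g-k}` on `Lʳ P^{k-2r} ⊆ ⋀ᵏ V`**, hence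
  **`Polarization.hodgeStar_apply_eq_mul_sum` — `∗x = E^{g-k} ∧ Σ_r (-1)^{(k-2r)(k-2r+1)/2} π_r x`** for every `x ∈ ⋀ᵏ V`.
* §2 **`Polarization.trace_mul_hodgeStar_eq_sum` — `tr(x ∧ ∗y) = Σ_r (-1)^{(k-2r)(k-2r+1)/2} Q_k(x, π_r y)`**, and in even degree
  **`Polarization.trace_mul_hodgeStar_eq_totalLefschetzForm` — `tr(x ∧ ∗y) = P(x, y)`** (Lange's (5.24), the form of `Q.exteriorPower`):
  André's "`∫ x ∪ *y`" IS the polarization form of `⋀^{2p} H`; `Polarization.trace_mul_hodgeStar_symm` (symmetry, "transposition").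
* §3 **POSITIVITY — `Polarization.trace_mul_hodgeStar_self_pos_of_mem_hodgeClasses`: `tr(x ∧ ∗x) > 0` for every non-zero rational
  Hodge class `x ∈ Bᵖ`, `2p ≤ g`** ("les mêmes propriétés de positivité sur les cycles réels de type `(p,p)`"; the Hodge standard
  positivity on the carrier, from the tree's `form_self_pos_of_mem_hodgeClasses` of `Q.exteriorPower`).
* §4 **`∗` PRESERVES HODGE CLASSES AND LEFSCHETZ (DIVISOR) CLASSES** ("if `u` is Lefschetz, then `ū` maps `D(A)` into `D(B)`", for
  `u = ∗`): `Polarization.hodgeStar_apply_mem_map_hodgeClasses` (`∗Bᵖ ⊆ B^{g-p}`), `Polarization.hodgeStar_apply_mem_map_divisorClasses`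
  (`∗Dᵖ ⊆ D^{g-p}`), and the equalities **`Polarization.map_hodgeStar_hodgeClasses_eq`** (`∗Bᵖ = B^{g-p}`),
  **`Polarization.map_hodgeStar_divisorClasses_eq`** (`∗Dᵖ = D^{g-p}`) as sub-spaces of `⋀ V` (injectivity of `∗` and `b_p = b_{g-p}`,
  `d_p = d_{g-p}` — hard Lefschetz on `B` and `D`, g28-#7/#8), with the mirrored halves `Polarization.map_hodgeStar_hodgeClasses_eq'` /
  `…divisorClasses_eq'` (`∗B^{g-p} = Bᵖ`, `∗D^{g-p} = Dᵖ`, by `∗² = 1`).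

## References

* [Andre1996Motifs] Y. André, *Pour une théorie inconditionnelle des motifs*, Publ. Math. IHÉS 83 (1996), §1.1 (pp. 10–11), Prop. 1.2.
* [Milne1999LefschetzClasses] J. S. Milne, *Lefschetz classes on abelian varieties*, Duke Math. J. 96 (1999), §5 p. 664, Prop. 5.7,
  Thm. 5.9 (p. 665).
* [Lange2023AbelianVarietiesComplex] H. Lange, *Abelian Varieties over the Complex Numbers* (2023), §5.4.1 (5.24), Thm. 5.4.2, Lemma 5.4.3,
  §7.3.2 (1)–(3).
* [Voisin2002] C. Voisin, *Hodge Theory and Complex Algebraic Geometry I* (2002), Lemma 6.31, Thm. 6.32.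
* [Kleiman1968AlgebraicCycles] S. L. Kleiman, *Algebraic cycles and the Weil conjectures* (1968), §1.4 (1.4.2) and §3 (the form `⟨x, ∗y⟩`).
-/

noncomputable section

namespace Literature.AlgebraicGeometry.Motives.HodgeStructure

open ExteriorLefschetz ExteriorAlgebra

universe u

variable {V : Type u} [AddCommGroup V] [Module ℚ V] [Module.Finite ℚ V] {n : ℤ} {H : HodgeStructure V n}
  (Q : Polarization H) (hn : Odd n) {g : ℕ} (hg : Module.finrank ℚ V = 2 * g)

/-! ## §1 `∗` on the Lefschetz components: `∗ = (-1)^{(k-2r)(k-2r+1)/2} L^{g-k}` on `Lʳ P^{k-2r}` -/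

include hn hg in
/-- **`∗x = (-1)^{(k-2r)(k-2r+1)/2} E^{g-k} ∧ x` for `x ∈ Lʳ P^{k-2r} ⊆ ⋀ᵏ V`** (`k ≤ g`): Milne's `∗(Lⁱ xᵢ) = (-1)^{(s-2i)(s-2i+1)/2} L^{d-s+i} xᵢ`
with `L^{d-s+i} xᵢ = L^{d-s}(Lⁱ xᵢ)`. [cite: Milne1999LefschetzClasses, §5 p. 664] [cite: Andre1996Motifs, §1.1 (p. 10)] -/
theorem Polarization.hodgeStar_apply_of_mem_lefschetzPart {k : ℕ} (hk : k ≤ g) {r : ℕ} (hr : 2 * r ≤ k) {x : ⋀[ℚ]^k V}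
    (hx : x ∈ (Q.lefschetzPart g k r).toSubmodule) :
    hodgeStar (Q.lefschetzClass : ExteriorAlgebra ℚ V) g (x : ExteriorAlgebra ℚ V) =
      ((-1 : ℚ) ^ ((k - 2 * r) * (k - 2 * r + 1) / 2)) • ((Q.lefschetzClass : ExteriorAlgebra ℚ V) ^ (g - k) * x) := by
  rw [Polarization.lefschetzPart, lefschetzSummandSub_toSubmodule, Submodule.mem_comap, Submodule.subtype_apply,
    mem_lefschetzSummand_iff hr] at hx
  obtain ⟨p, hp, hpx⟩ := hx
  rw [← hpx, (Q.isSymplectic_lefschetzClass hn hg).hodgeStar_apply_pow_mul_of_mem_primitive (by omega) hp (by omega),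
    ← mul_assoc, ← pow_add, show g - k + r = g - (k - 2 * r) - r by omega]

include hn hg in
/-- **`∗x = E^{g-k} ∧ Σ_r (-1)^{(k-2r)(k-2r+1)/2} π_r x` for every `x ∈ ⋀ᵏ V`, `k ≤ g`** (`x = Σ_r π_r x`, `π_r x ∈ Lʳ P^{k-2r}`).
[cite: Milne1999LefschetzClasses, §5 p. 664] [cite: Lange2023AbelianVarietiesComplex, Thm. 5.4.2] -/
theorem Polarization.hodgeStar_apply_eq_mul_sum {k : ℕ} (hk : k ≤ g) (x : ⋀[ℚ]^k V) :
    hodgeStar (Q.lefschetzClass : ExteriorAlgebra ℚ V) g (x : ExteriorAlgebra ℚ V) =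
      (Q.lefschetzClass : ExteriorAlgebra ℚ V) ^ (g - k) *
        ((∑ r ∈ Finset.range (k / 2 + 1), ((-1 : ℚ) ^ ((k - 2 * r) * (k - 2 * r + 1) / 2)) •
          (Q.lefschetzProj hn hg hk r).toLinearMap x : ⋀[ℚ]^k V) : ExteriorAlgebra ℚ V) := by
  conv_lhs => rw [← Q.sum_lefschetzProj_apply hn hg hk x]
  rw [AddSubmonoidClass.coe_finsetSum, AddSubmonoidClass.coe_finsetSum, map_sum, Finset.mul_sum]
  refine Finset.sum_congr rfl fun r hr ↦ ?_
  rw [Q.hodgeStar_apply_of_mem_lefschetzPart hn hg hk (by rw [Finset.mem_range] at hr; omega) (Q.lefschetzProj_apply_mem hn hg hk r x),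
    Submodule.coe_smul, mul_smul_comm]

/-! ## §2 The pairing `tr(x ∧ ∗y)` is Lange's `P` in even degree -/

include hn hg in
/-- **`tr(x ∧ ∗y) = Σ_r (-1)^{(k-2r)(k-2r+1)/2} Q_k(x, π_r y)`** for `x, y ∈ ⋀ᵏ V`, `k ≤ g` (`Q_k(a, b) = tr(E^{g-k} ∧ a ∧ b)`, `E^{g-k}` central).
[cite: Andre1996Motifs, §1.1 and Prop. 1.2 (p. 11: "la forme bilinéaire (x, y) ↦ ∫ x ∪ *y")] [cite: Voisin2002, §6.3.2 (p. 128: Q(α, β) = ∫ L^{n-k} α ∧ β)] -/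
theorem Polarization.trace_mul_hodgeStar_eq_sum {k : ℕ} (hk : k ≤ g) (x y : ⋀[ℚ]^k V) :
    ExteriorLefschetz.trace (Q.lefschetzClass : ExteriorAlgebra ℚ V) g
        ((x : ExteriorAlgebra ℚ V) * hodgeStar (Q.lefschetzClass : ExteriorAlgebra ℚ V) g (y : ExteriorAlgebra ℚ V)) =
      ∑ r ∈ Finset.range (k / 2 + 1), (-1 : ℚ) ^ ((k - 2 * r) * (k - 2 * r + 1) / 2) *
        lefschetzForm (Q.lefschetzClass : ExteriorAlgebra ℚ V) g k x ((Q.lefschetzProj hn hg hk r).toLinearMap y) := by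
  rw [Q.hodgeStar_apply_eq_mul_sum hn hg hk y, ← mul_assoc,
    ← pow_mul_comm_of_mem_two Q.lefschetzClass.2 (g - k) (x : ExteriorAlgebra ℚ V), mul_assoc, AddSubmonoidClass.coe_finsetSum,
    Finset.mul_sum, Finset.mul_sum, map_sum]
  refine Finset.sum_congr rfl fun r _ ↦ ?_
  rw [Submodule.coe_smul, mul_smul_comm, mul_smul_comm, map_smul, smul_eq_mul, lefschetzForm_apply]

include hn hg in
/-- `Q_k(x, π_r y) = Q_k(π_r x, π_r y)` (the Lefschetz components are `Q_k`-orthogonal, Voisin's Lemma 6.31). [cite: Voisin2002, Lemma 6.31] -/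
theorem Polarization.lefschetzForm_apply_lefschetzProj_right {k : ℕ} (hk : k ≤ g) (r : ℕ) (x y : ⋀[ℚ]^k V) :
    lefschetzForm (Q.lefschetzClass : ExteriorAlgebra ℚ V) g k x ((Q.lefschetzProj hn hg hk r).toLinearMap y) =
      lefschetzForm (Q.lefschetzClass : ExteriorAlgebra ℚ V) g k ((Q.lefschetzProj hn hg hk r).toLinearMap x)
        ((Q.lefschetzProj hn hg hk r).toLinearMap y) := by
  conv_lhs => rw [← Q.sum_lefschetzProj_apply hn hg hk x]
  rw [map_sum, LinearMap.sum_apply, Finset.sum_eq_single r]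
  · intro s _ hsr
    exact lefschetzForm_eq_zero_of_mem_lefschetzSummandSub_of_ne H Q.lefschetzClass_mem_hodgeClasses hk hsr
      (Q.lefschetzProj_apply_mem hn hg hk s x) (Q.lefschetzProj_apply_mem hn hg hk r y)
  · intro h
    rw [Q.lefschetzProj_eq_zero hn hg hk (by rw [Finset.mem_range] at h; omega), Hom.zero_toLinearMap, LinearMap.zero_apply, map_zero,
      LinearMap.zero_apply]

/-- The sign of `∗` in even degree `k = 2p` is Lange's: `(-1)^{(2p-2r)(2p-2r+1)/2} = (-1)^{2p(2p-1)/2 + r}` (`r ≤ p`). [folklore] -/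
private theorem neg_one_pow_sign_even {p r : ℕ} (hr : r ≤ p) :
    (-1 : ℚ) ^ ((2 * p - 2 * r) * (2 * p - 2 * r + 1) / 2) = (-1 : ℚ) ^ (2 * p * (2 * p - 1) / 2 + r) := by
  obtain ⟨m, rfl⟩ : ∃ m, p = r + m := ⟨p - r, by omega⟩
  have h1 : (2 * (r + m) - 2 * r) * (2 * (r + m) - 2 * r + 1) / 2 = m * (2 * m + 1) := by
    rw [show 2 * (r + m) - 2 * r = 2 * m by omega, mul_assoc, Nat.mul_div_cancel_left _ two_pos]
  have h2 : 2 * (r + m) * (2 * (r + m) - 1) / 2 = (r + m) * (2 * (r + m) - 1) := by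
    rw [mul_assoc, Nat.mul_div_cancel_left _ two_pos]
  rw [h1, h2]
  have e1 : (-1 : ℚ) ^ (m * (2 * m + 1)) = (-1) ^ m := by
    rw [pow_mul', Odd.neg_one_pow ⟨m, rfl⟩]
  rcases Nat.eq_zero_or_pos (r + m) with h0 | hpos
  · have hr0 : r = 0 := by omega
    have hm0 : m = 0 := by omega
    subst hr0; subst hm0; simp
  · have e2 : (-1 : ℚ) ^ ((r + m) * (2 * (r + m) - 1)) = (-1) ^ (r + m) := by
      rw [pow_mul', Odd.neg_one_pow ⟨r + m - 1, by omega⟩]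
    rw [e1, pow_add, e2, pow_add, mul_comm ((-1 : ℚ) ^ r) ((-1) ^ m), mul_assoc, ← pow_add (-1 : ℚ) r r, ← two_mul, pow_mul,
      neg_one_sq, one_pow, mul_one]

include hn hg in
/-- **IN EVEN DEGREE `tr(x ∧ ∗y)` IS LANGE'S FORM `P(x, y) = Σ_r (-1)^{k(k-1)/2 + r} Q_k(π_r x, π_r y)` (5.24), the form of the polarization
`Q.exteriorPower` of `⋀^{2p} H`** (`2p ≤ g`): André's "`∫ x ∪ *y`" on the carrier. [cite: Andre1996Motifs, Prop. 1.2 (p. 11)] [cite: Lange2023AbelianVarietiesComplex, §5.4.1 (5.24)] [cite: Voisin2002, Thm. 6.32] -/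
theorem Polarization.trace_mul_hodgeStar_eq_totalLefschetzForm {p : ℕ} (hk : 2 * p ≤ g) (x y : ⋀[ℚ]^(2 * p) V) :
    ExteriorLefschetz.trace (Q.lefschetzClass : ExteriorAlgebra ℚ V) g
        ((x : ExteriorAlgebra ℚ V) * hodgeStar (Q.lefschetzClass : ExteriorAlgebra ℚ V) g (y : ExteriorAlgebra ℚ V)) =
      Q.totalLefschetzForm hn hg hk x y := by
  rw [Q.trace_mul_hodgeStar_eq_sum hn hg hk, Q.totalLefschetzForm_apply hn hg hk]
  refine Finset.sum_congr rfl fun r hr ↦ ?_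
  rw [Q.lefschetzForm_apply_lefschetzProj_right hn hg hk r x y, neg_one_pow_sign_even (by rw [Finset.mem_range] at hr; omega)]

include hn hg in
/-- Hence `tr(x ∧ ∗y) = Q.exteriorPower.form x y` on `⋀^{2p} V`. [cite: Lange2023AbelianVarietiesComplex, §5.4.1 (5.24)] [cite: Voisin2002, Thm. 6.32] -/
theorem Polarization.trace_mul_hodgeStar_eq_exteriorPower_form {p : ℕ} (hk : 2 * p ≤ g) (x y : ⋀[ℚ]^(2 * p) V) :
    ExteriorLefschetz.trace (Q.lefschetzClass : ExteriorAlgebra ℚ V) g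
        ((x : ExteriorAlgebra ℚ V) * hodgeStar (Q.lefschetzClass : ExteriorAlgebra ℚ V) g (y : ExteriorAlgebra ℚ V)) =
      (Q.exteriorPower hn hg hk).form x y := by
  rw [Q.exteriorPower_form, Q.trace_mul_hodgeStar_eq_totalLefschetzForm hn hg hk]

include hn hg in
/-- **`tr(x ∧ ∗y) = tr(y ∧ ∗x)` in even degree** (the form is symmetric: "la transposition relative à la forme bilinéaire
`(x, y) ↦ ∫ x ∪ *y`"). [cite: Andre1996Motifs, Prop. 1.2 (p. 11)] [cite: Lange2023AbelianVarietiesComplex, Lemma 5.4.3 (a)] -/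
theorem Polarization.trace_mul_hodgeStar_symm {p : ℕ} (hk : 2 * p ≤ g) (x y : ⋀[ℚ]^(2 * p) V) :
    ExteriorLefschetz.trace (Q.lefschetzClass : ExteriorAlgebra ℚ V) g
        ((x : ExteriorAlgebra ℚ V) * hodgeStar (Q.lefschetzClass : ExteriorAlgebra ℚ V) g (y : ExteriorAlgebra ℚ V)) =
      ExteriorLefschetz.trace (Q.lefschetzClass : ExteriorAlgebra ℚ V) g
        ((y : ExteriorAlgebra ℚ V) * hodgeStar (Q.lefschetzClass : ExteriorAlgebra ℚ V) g (x : ExteriorAlgebra ℚ V)) := by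
  rw [Q.trace_mul_hodgeStar_eq_totalLefschetzForm hn hg hk, Q.trace_mul_hodgeStar_eq_totalLefschetzForm hn hg hk]
  have h := LinearMap.congr_fun₂ (Q.totalLefschetzForm_flip hn hg hk) y x
  have hev : ((((2 * p : ℕ) : ℤ)) * n).negOnePow = 1 := Int.negOnePow_even _ ⟨(p : ℤ) * n, by push_cast; ring⟩
  rw [LinearMap.BilinForm.flip_apply, LinearMap.smul_apply, LinearMap.smul_apply, hev, Units.val_one, one_smul] at h
  exact h

/-! ## §3 Positivity of `tr(x ∧ ∗x)` on Hodge classes -/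

include hn hg in
/-- **POSITIVITY OF `(x, y) ↦ tr(x ∧ ∗y)` ON HODGE CLASSES: `tr(x ∧ ∗x) > 0` for every non-zero rational Hodge class `x ∈ Bᵖ = Hdg(⋀^{2p} H)`,
`2p ≤ g`** — André: `*_H` has "les mêmes propriétés de positivité sur les cycles réels de type `(p,p)`" as the Hodge star; on the carrier
it is the Hodge–Riemann positivity of `Q.exteriorPower` on the rational `(p,p)`-classes (the tree's `form_self_pos_of_mem_hodgeClasses`).
[cite: Andre1996Motifs, §1.1 (p. 11)] [cite: Voisin2002, Thm. 6.32] [cite: Kleiman1968AlgebraicCycles, §3 (the form ⟨x, ∗y⟩ on algebraic cycles)] -/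
theorem Polarization.trace_mul_hodgeStar_self_pos_of_mem_hodgeClasses {p : ℕ} (hk : 2 * p ≤ g) {x : ⋀[ℚ]^(2 * p) V}
    (hx : x ∈ (H.exteriorPower (2 * p)).hodgeClasses (p * n)) (hx0 : x ≠ 0) :
    0 < ExteriorLefschetz.trace (Q.lefschetzClass : ExteriorAlgebra ℚ V) g
        ((x : ExteriorAlgebra ℚ V) * hodgeStar (Q.lefschetzClass : ExteriorAlgebra ℚ V) g (x : ExteriorAlgebra ℚ V)) := by
  rw [Q.trace_mul_hodgeStar_eq_exteriorPower_form hn hg hk]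
  exact (Q.exteriorPower hn hg hk).form_self_pos_of_mem_hodgeClasses (by push_cast; ring) hx hx0

include hn hg in
/-- Non-degeneracy on Hodge classes, as a corollary: a Hodge class `x ∈ Bᵖ` with `tr(x ∧ ∗x) = 0` is zero (`2p ≤ g`).
[cite: Andre1996Motifs, §1.1 (p. 11)] [cite: Voisin2002, Thm. 6.32] -/
theorem Polarization.eq_zero_of_trace_mul_hodgeStar_self_eq_zero {p : ℕ} (hk : 2 * p ≤ g) {x : ⋀[ℚ]^(2 * p) V}
    (hx : x ∈ (H.exteriorPower (2 * p)).hodgeClasses (p * n))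
    (h0 : ExteriorLefschetz.trace (Q.lefschetzClass : ExteriorAlgebra ℚ V) g
        ((x : ExteriorAlgebra ℚ V) * hodgeStar (Q.lefschetzClass : ExteriorAlgebra ℚ V) g (x : ExteriorAlgebra ℚ V)) = 0) :
    x = 0 := by
  by_contra hx0
  exact (Q.trace_mul_hodgeStar_self_pos_of_mem_hodgeClasses hn hg hk hx hx0).ne' h0

/-! ## §4 `∗` preserves Hodge classes and divisor classes: `∗Bᵖ = B^{g-p}`, `∗Dᵖ = D^{g-p}` -/

include hn hg in
/-- The signed sum `Σ_r ε_r π_r x` of a Hodge class is a Hodge class (the `π_r` are morphisms of Hodge structures).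
[cite: Lange2023AbelianVarietiesComplex, §5.4.1 (5.23)] [cite: Deligne1982HodgeCycles, I §2, 2.1 (c)] -/
theorem Polarization.sum_smul_lefschetzProj_mem_hodgeClasses {k : ℕ} (hk : k ≤ g) (c : ℕ → ℚ) {q : ℤ} {x : ⋀[ℚ]^k V}
    (hx : x ∈ (H.exteriorPower k).hodgeClasses q) :
    (∑ r ∈ Finset.range (k / 2 + 1), c r • (Q.lefschetzProj hn hg hk r).toLinearMap x) ∈ (H.exteriorPower k).hodgeClasses q :=
  Submodule.sum_mem _ fun r _ ↦ Submodule.smul_mem _ _ ((Q.lefschetzProj hn hg hk r).map_hodgeClasses_le q ⟨x, hx, rfl⟩)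

include hn hg in
/-- **`∗` MAPS HODGE CLASSES TO HODGE CLASSES: `∗Bᵖ ⊆ Bᵐ`, `p + m = g`** (`2p ≤ g`; as sub-spaces of `⋀ V`: `∗x = E^{g-2p} ∧ Σ ε_r π_r x`
with `Σ ε_r π_r x ∈ Bᵖ` and `E^{g-2p} ∧ Bᵖ ⊆ B^{g-p}`) — Milne's "if `u` is Lefschetz, then `ū` maps [Hodge/Lefschetz classes into
themselves]" for `u = ∗`. [cite: Milne1999LefschetzClasses, §5 Prop. 5.7 and Thm. 5.9 (pp. 664–665)] [cite: Deligne1982HodgeCycles, I §2, 2.1 (c)] -/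
theorem Polarization.hodgeStar_apply_mem_map_hodgeClasses {p m : ℕ} (hk : 2 * p ≤ g) (hpm : p + m = g) {x : ⋀[ℚ]^(2 * p) V}
    (hx : x ∈ (H.exteriorPower (2 * p)).hodgeClasses (p * n)) :
    hodgeStar (Q.lefschetzClass : ExteriorAlgebra ℚ V) g (x : ExteriorAlgebra ℚ V) ∈
      ((H.exteriorPower (2 * m)).hodgeClasses (m * n)).map (⋀[ℚ]^(2 * m) V).subtype := by
  have h : 2 * (g - 2 * p) + 2 * p = 2 * m := by omega
  set z : ⋀[ℚ]^(2 * p) V := ∑ r ∈ Finset.range (2 * p / 2 + 1), ((-1 : ℚ) ^ ((2 * p - 2 * r) * (2 * p - 2 * r + 1) / 2)) •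
    (Q.lefschetzProj hn hg hk r).toLinearMap x with hz_def
  have hz : z ∈ (H.exteriorPower (2 * p)).hodgeClasses (p * n) := Q.sum_smul_lefschetzProj_mem_hodgeClasses hn hg hk _ hx
  refine ⟨lefschetzPow (Q.lefschetzClass : ExteriorAlgebra ℚ V) Q.lefschetzClass.2 (g - 2 * p) h z, ?_, ?_⟩
  · have h1 := lefschetzPow_mem_hodgeClasses H Q.lefschetzClass_mem_hodgeClasses (g - 2 * p) h hz
    have hw : (p : ℤ) * n + ((g - 2 * p : ℕ) : ℤ) * n = (m : ℤ) * n := by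
      rw [← add_mul, ← Nat.cast_add, show p + (g - 2 * p) = m by omega]
    rw [hw] at h1
    exact h1
  · rw [Submodule.subtype_apply, lefschetzPow_apply_coe, Q.hodgeStar_apply_eq_mul_sum hn hg hk x]

include hn hg in
/-- **`∗` MAPS DIVISOR (LEFSCHETZ) CLASSES TO DIVISOR CLASSES: `∗Dᵖ ⊆ Dᵐ`, `p + m = g`** (`2p ≤ g`; `π_r Dᵖ ⊆ Dᵖ` by g28-#8 and
`E^{g-2p} ∧ Dᵖ ⊆ D^{g-p}`) — "If `u` is Lefschetz, then `ū` maps `D(A)_k` into `D(B)_k`" for `u = ∗`.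
[cite: Milne1999LefschetzClasses, §5 Prop. 5.7 and Thm. 5.9 (pp. 664–665)] -/
theorem Polarization.hodgeStar_apply_mem_map_divisorClasses {p m : ℕ} (hk : 2 * p ≤ g) (hpm : p + m = g) {x : ⋀[ℚ]^(2 * p) V}
    (hx : x ∈ H.divisorClasses p) :
    hodgeStar (Q.lefschetzClass : ExteriorAlgebra ℚ V) g (x : ExteriorAlgebra ℚ V) ∈
      (H.divisorClasses m).map (⋀[ℚ]^(2 * m) V).subtype := by
  have h : 2 * (g - 2 * p) + 2 * p = 2 * m := by omega
  set z : ⋀[ℚ]^(2 * p) V := ∑ r ∈ Finset.range (2 * p / 2 + 1), ((-1 : ℚ) ^ ((2 * p - 2 * r) * (2 * p - 2 * r + 1) / 2)) •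
    (Q.lefschetzProj hn hg hk r).toLinearMap x with hz_def
  have hz : z ∈ H.divisorClasses p :=
    Submodule.sum_mem _ fun r _ ↦ Submodule.smul_mem _ _ (Q.lefschetzProj_apply_mem_divisorClasses hn hg hk hx r)
  refine ⟨lefschetzPow (Q.lefschetzClass : ExteriorAlgebra ℚ V) Q.lefschetzClass.2 (g - 2 * p) h z,
    map_lefschetzPow_divisorClasses_le H Q.lefschetzClass_mem_hodgeClasses (g - 2 * p) h ⟨z, hz, rfl⟩, ?_⟩
  rw [Submodule.subtype_apply, lefschetzPow_apply_coe, Q.hodgeStar_apply_eq_mul_sum hn hg hk x]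

include hn hg in
/-- `∗` is injective on `⋀ V` (it is an involution). [cite: Andre1996Motifs, §1.1 (p. 10, "involutions")] -/
theorem Polarization.hodgeStar_injective :
    Function.Injective (hodgeStar (Q.lefschetzClass : ExteriorAlgebra ℚ V) g) := by
  intro x y hxy
  have h := (Q.isSymplectic_lefschetzClass hn hg).hodgeStar_mul_self
  rw [← Module.End.one_apply (R := ℚ) x, ← Module.End.one_apply (R := ℚ) y, ← h, Module.End.mul_apply, Module.End.mul_apply, hxy]

include hn hg in
/-- **`∗Bᵖ = Bᵐ`, `p + m = g`** (`2p ≤ g`), as sub-spaces of `⋀ V`: `∗` is injective and `b_p = b_{g-p}` (hard Lefschetz on Hodge classes,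
g28-#7). [cite: Milne1999LefschetzClasses, §5 Thm. 5.9 (p. 665)] [cite: Deligne1982HodgeCycles, I §2, 2.1 (c)] -/
theorem Polarization.map_hodgeStar_hodgeClasses_eq {p m : ℕ} (hk : 2 * p ≤ g) (hpm : p + m = g) :
    ((H.exteriorPower (2 * p)).hodgeClasses (p * n)).map
        (hodgeStar (Q.lefschetzClass : ExteriorAlgebra ℚ V) g ∘ₗ (⋀[ℚ]^(2 * p) V).subtype) =
      ((H.exteriorPower (2 * m)).hodgeClasses (m * n)).map (⋀[ℚ]^(2 * m) V).subtype := by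
  refine Submodule.eq_of_le_of_finrank_eq ?_ ?_
  · rintro _ ⟨x, hx, rfl⟩
    exact Q.hodgeStar_apply_mem_map_hodgeClasses hn hg hk hpm hx
  · rw [← LinearEquiv.finrank_eq (Submodule.equivMapOfInjective _
        (by rw [LinearMap.coe_comp]; exact (Q.hodgeStar_injective hn hg).comp (Submodule.injective_subtype _)) _),
      ← LinearEquiv.finrank_eq (Submodule.equivMapOfInjective _ (Submodule.injective_subtype _) _)]
    have h1 := Q.finrank_hodgeClasses_exteriorPower_eq_of_add_eq hn hg (k := 2 * p) (j := g - 2 * p) (m := 2 * m)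
      (by omega) (by omega) (p * n)
    have hw : (p : ℤ) * n + ((g - 2 * p : ℕ) : ℤ) * n = (m : ℤ) * n := by
      rw [← add_mul, ← Nat.cast_add, show p + (g - 2 * p) = m by omega]
    rw [hw] at h1
    exact h1

include hn hg in
/-- **`∗Dᵖ = Dᵐ`, `p + m = g`** (`2p ≤ g`), as sub-spaces of `⋀ V`: `∗` is injective and `d_p = d_{g-p}` (hard Lefschetz on divisor classes,
g28-#8 / Milne's Cor. 5.3). [cite: Milne1999LefschetzClasses, §5 Prop. 5.7, Thm. 5.9 (pp. 664–665)] -/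
theorem Polarization.map_hodgeStar_divisorClasses_eq {p m : ℕ} (hk : 2 * p ≤ g) (hpm : p + m = g) :
    (H.divisorClasses p).map (hodgeStar (Q.lefschetzClass : ExteriorAlgebra ℚ V) g ∘ₗ (⋀[ℚ]^(2 * p) V).subtype) =
      (H.divisorClasses m).map (⋀[ℚ]^(2 * m) V).subtype := by
  have h : 2 * (g - 2 * p) + 2 * p = 2 * m := by omega
  refine Submodule.eq_of_le_of_finrank_eq ?_ ?_
  · rintro _ ⟨x, hx, rfl⟩
    exact Q.hodgeStar_apply_mem_map_divisorClasses hn hg hk hpm hx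
  · rw [← LinearEquiv.finrank_eq (Submodule.equivMapOfInjective _
        (by rw [LinearMap.coe_comp]; exact (Q.hodgeStar_injective hn hg).comp (Submodule.injective_subtype _)) _),
      ← LinearEquiv.finrank_eq (Submodule.equivMapOfInjective _ (Submodule.injective_subtype _) _),
      ← Q.map_lefschetzPow_divisorClasses_eq hn hg (j := g - 2 * p) (by omega) h]
    exact LinearEquiv.finrank_eq
      (Submodule.equivMapOfInjective _ ((Q.isSymplectic_lefschetzClass hn hg).lefschetzPow_injective (by omega) h) _)

include hn hg in
/-- The mirrored half **`∗Bᵐ = Bᵖ`** (`2p ≤ g`, `p + m = g`; apply the involution `∗` to `∗Bᵖ = Bᵐ`) — so `∗` exchanges `Bᵖ` and `B^{g-p}`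
in all degrees. [cite: Milne1999LefschetzClasses, §5 Thm. 5.9 (p. 665)] [cite: Andre1996Motifs, §1.1 (p. 10)] -/
theorem Polarization.map_hodgeStar_hodgeClasses_eq' {p m : ℕ} (hk : 2 * p ≤ g) (hpm : p + m = g) :
    ((H.exteriorPower (2 * m)).hodgeClasses (m * n)).map
        (hodgeStar (Q.lefschetzClass : ExteriorAlgebra ℚ V) g ∘ₗ (⋀[ℚ]^(2 * m) V).subtype) =
      ((H.exteriorPower (2 * p)).hodgeClasses (p * n)).map (⋀[ℚ]^(2 * p) V).subtype := by
  have h := congrArg (Submodule.map (hodgeStar (Q.lefschetzClass : ExteriorAlgebra ℚ V) g)) (Q.map_hodgeStar_hodgeClasses_eq hn hg hk hpm)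
  rw [Submodule.map_comp, ← h, ← Submodule.map_comp, ← LinearMap.comp_assoc, ← Module.End.mul_eq_comp,
    (Q.isSymplectic_lefschetzClass hn hg).hodgeStar_mul_self, Module.End.one_eq_id, LinearMap.id_comp]

include hn hg in
/-- The mirrored half **`∗Dᵐ = Dᵖ`** (`2p ≤ g`, `p + m = g`). [cite: Milne1999LefschetzClasses, §5 Thm. 5.9 (p. 665)] [cite: Andre1996Motifs, §1.1 (p. 10)] -/
theorem Polarization.map_hodgeStar_divisorClasses_eq' {p m : ℕ} (hk : 2 * p ≤ g) (hpm : p + m = g) :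
    (H.divisorClasses m).map (hodgeStar (Q.lefschetzClass : ExteriorAlgebra ℚ V) g ∘ₗ (⋀[ℚ]^(2 * m) V).subtype) =
      (H.divisorClasses p).map (⋀[ℚ]^(2 * p) V).subtype := by
  have h := congrArg (Submodule.map (hodgeStar (Q.lefschetzClass : ExteriorAlgebra ℚ V) g)) (Q.map_hodgeStar_divisorClasses_eq hn hg hk hpm)
  rw [Submodule.map_comp, ← h, ← Submodule.map_comp, ← LinearMap.comp_assoc, ← Module.End.mul_eq_comp,
    (Q.isSymplectic_lefschetzClass hn hg).hodgeStar_mul_self, Module.End.one_eq_id, LinearMap.id_comp]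

/-! ## §5 Positivity above the middle degree -/

include hn hg in
/-- **Positivity in ALL degrees: `tr(x ∧ ∗x) > 0` for every non-zero rational Hodge class `x ∈ Hdg(⋀^{2m} H)`, `m ≤ g`.** For `2m ≥ g`
write `m = g - p` with `2p ≤ g`: `∗x = y ∈ Bᵖ` (§4), `x = ∗y`, and `tr(x ∧ ∗x) = tr(∗y ∧ y) = tr(y ∧ ∗y) > 0` (§3; even elements commute).
[cite: Andre1996Motifs, §1.1 (p. 11)] [cite: Voisin2002, Thm. 6.32] -/
theorem Polarization.trace_mul_hodgeStar_self_pos_of_mem_hodgeClasses' {p m : ℕ} (hk : 2 * p ≤ g) (hpm : p + m = g)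
    {x : ⋀[ℚ]^(2 * m) V} (hx : x ∈ (H.exteriorPower (2 * m)).hodgeClasses (m * n)) (hx0 : x ≠ 0) :
    0 < ExteriorLefschetz.trace (Q.lefschetzClass : ExteriorAlgebra ℚ V) g
        ((x : ExteriorAlgebra ℚ V) * hodgeStar (Q.lefschetzClass : ExteriorAlgebra ℚ V) g (x : ExteriorAlgebra ℚ V)) := by
  -- `∗x = y` with `y ∈ Bᵖ`
  have hmem : hodgeStar (Q.lefschetzClass : ExteriorAlgebra ℚ V) g (x : ExteriorAlgebra ℚ V) ∈
      ((H.exteriorPower (2 * p)).hodgeClasses (p * n)).map (⋀[ℚ]^(2 * p) V).subtype := by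
    rw [← Q.map_hodgeStar_hodgeClasses_eq' hn hg hk hpm]
    exact ⟨x, hx, rfl⟩
  obtain ⟨y, hy, hyx⟩ := hmem
  rw [Submodule.subtype_apply] at hyx
  have hxy : hodgeStar (Q.lefschetzClass : ExteriorAlgebra ℚ V) g (y : ExteriorAlgebra ℚ V) = x := by
    rw [hyx, ← Module.End.mul_apply, (Q.isSymplectic_lefschetzClass hn hg).hodgeStar_mul_self, Module.End.one_apply]
  have hy0 : y ≠ 0 := by
    rintro rfl
    apply hx0
    have h0 : (x : ExteriorAlgebra ℚ V) = 0 := by rw [← hxy, ZeroMemClass.coe_zero, map_zero]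
    exact ZeroMemClass.coe_eq_zero.1 h0
  -- `x ∧ ∗x = ∗y ∧ y = y ∧ ∗y`
  have hcomm : (x : ExteriorAlgebra ℚ V) * (y : ExteriorAlgebra ℚ V) = (y : ExteriorAlgebra ℚ V) * x := by
    rw [mul_comm_of_mem x.2 y.2, show 2 * m * (2 * p) = 2 * (m * (2 * p)) by ring, pow_mul, neg_one_sq, one_pow, one_smul]
  rw [← hyx, hcomm, ← hxy]
  exact Q.trace_mul_hodgeStar_self_pos_of_mem_hodgeClasses hn hg hk hy hy0

end Literature.AlgebraicGeometry.Motives.HodgeStructure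

end
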